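import Summits.CriticalPhenomena.PercolationContinuityZ3.Theorems.PercNearOneGluingNoHeavyLowerTailTwoLinkDeficitLeFive
import HarnessLib

/-!
# The siblings `V13`, `V15`, `V12` of the two-link deficit row `W0` on every weighted graph with at most five vertices

Support file for crux `stmt-CriticalPhenomena-4575` (`NoHeavyLowerTail`), seat `prim-l12-p1` gen 15 (`--supports stmt-CriticalPhenomena-4575`;
COMPUTATIONAL: six `checkC` evaluations use `native_decide`).  Memos `run/shared/lean/prim/prim-l12/FROM-prim-l12-p1-g12-W0-TWO-LINK-DEFICIT.md` (the family)
and `…/FROM-prim-l12-p1-g15-TERMWISE-ROW-AND-3PT.md` (the termwise reduction `(**) ⟹ W0 ⟹ V13`, `(***) ⟹ V15 ⟹ V12`).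

With the cells of `…TwoLinkDeficitLeFive` (`P(π)` = probability that the open clusters of `prodBernoulli w` induce the partition `π` of `{a,b,c,y}`), the three rows are

  `(V13)  P(ab|c|y)·P(a|b|cy) ≤ P(ab|cy)·[P(∅) + P(ab|c|y) + P(a|b|cy)] + P(∅)·[P(a|bcy) + P(acy|b)]`,
  `(V15)  P(ab|c|y)·P(a|b|cy) ≤ P(ab|cy)·[P(∅) + P(ab|c|y)] + P(∅)·[P(a|bcy) + P(acy|b) + P(aby|c) + P(abc|y)]`,
  `(V12)  P(ab|c|y)·P(a|b|cy) ≤ P(ab|cy)·[P(∅) + P(ab|c|y) + P(a|b|cy)] + P(∅)·[P(a|bcy) + P(acy|b) + P(aby|c) + P(abc|y)]`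

(`∅ = a|b|c|y`).  Each is implied by `W0` plus nonnegative terms, so the files' content is only that the kernel confirms them independently; `V12` is the row for
which a single Gladkov–Zimin swap tree exists on every fibre tested (memo gen 13/14), `V15`/`V12` are the conclusions of the termwise row `(***)` (memo gen 15).
Evidence for all `n`: two-copy comb positive on simple `(8,≤14)`, `(9,≤13)` and `≤2`-fold `(7,≤12)`, `(8,≤11)` fibres (kit j156068, `0` violations).  THIS FILE proves the three
rows for every `n ≤ 5`, every weight vector and all pairwise distinct `a b c y` by `CombRows.quad_cval_le_five` (equivariance by `rfl`, `checkC` at `K₄` and `K₅`).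
Nothing is claimed here beyond five vertices.

Main results: `v13_cval_le_five`, `v15_cval_le_five`, `v12_cval_le_five` (term form; the cells are the `connEvent`s of `TwoLinkDeficit.pBot, pSab, pScy, pP11, pKa, pKb`
and of the two new predicates `pKc`, `pKy`, whose `openConn` descriptions are recorded).
-/

namespace Summit.CriticalPhenomena.PercolationContinuityZ3.Theorems.TwoLinkDeficit

open Finset MeasureTheory OneCutCert CovTransferCert E3GroupSepCert CombRows
open scoped BigOperators
open Literature.Probability.Percolation Literature.Probability.LatticeModels

variable {n : ℕ}

/-- Cell `aby|c` (`a,b,y` joined, `c` apart). [this work] -/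
def pKc (a b c y : Fin n) : CRel n → Bool := fun r => r a b && !(r a c) && r a y && !(r b c) && r b y && !(r c y)
/-- Cell `abc|y` (`a,b,c` joined, `y` apart). [this work] -/
def pKy (a b c y : Fin n) : CRel n → Bool := fun r => r a b && r a c && !(r a y) && r b c && !(r b y) && !(r c y)

/-- The six signed terms of `V13` (right side minus left side). [this work] -/
def v13Terms (n : ℕ) (x : Quad n) : List (CTerm n) :=
  let a := x.1
  let b := x.2.1
  let c := x.2.2.1
  let y := x.2.2.2
  [((1 : ℤ), pTrue, pP11 a b c y, pBot a b c y), ((1 : ℤ), pTrue, pP11 a b c y, pSab a b c y), ((1 : ℤ), pTrue, pP11 a b c y, pScy a b c y),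
    ((1 : ℤ), pTrue, pBot a b c y, pKa a b c y), ((1 : ℤ), pTrue, pBot a b c y, pKb a b c y),
    ((-1 : ℤ), pTrue, pSab a b c y, pScy a b c y)]

/-- The seven signed terms of `V15` (right side minus left side). [this work] -/
def v15Terms (n : ℕ) (x : Quad n) : List (CTerm n) :=
  let a := x.1
  let b := x.2.1
  let c := x.2.2.1
  let y := x.2.2.2
  [((1 : ℤ), pTrue, pP11 a b c y, pBot a b c y), ((1 : ℤ), pTrue, pP11 a b c y, pSab a b c y),
    ((1 : ℤ), pTrue, pBot a b c y, pKa a b c y), ((1 : ℤ), pTrue, pBot a b c y, pKb a b c y),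
    ((1 : ℤ), pTrue, pBot a b c y, pKc a b c y), ((1 : ℤ), pTrue, pBot a b c y, pKy a b c y),
    ((-1 : ℤ), pTrue, pSab a b c y, pScy a b c y)]

/-- The eight signed terms of `V12` (right side minus left side). [this work] -/
def v12Terms (n : ℕ) (x : Quad n) : List (CTerm n) :=
  let a := x.1
  let b := x.2.1
  let c := x.2.2.1
  let y := x.2.2.2
  [((1 : ℤ), pTrue, pP11 a b c y, pBot a b c y), ((1 : ℤ), pTrue, pP11 a b c y, pSab a b c y), ((1 : ℤ), pTrue, pP11 a b c y, pScy a b c y),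
    ((1 : ℤ), pTrue, pBot a b c y, pKa a b c y), ((1 : ℤ), pTrue, pBot a b c y, pKb a b c y),
    ((1 : ℤ), pTrue, pBot a b c y, pKc a b c y), ((1 : ℤ), pTrue, pBot a b c y, pKy a b c y),
    ((-1 : ℤ), pTrue, pSab a b c y, pScy a b c y)]

/-- `v13Terms` commutes with vertex relabellings. [this work] -/
theorem v13Terms_equivariant : QuadEquivariant v13Terms := by
  intro n τ x
  obtain ⟨a, b, c, y⟩ := x
  rfl
/-- `v15Terms` commutes with vertex relabellings. [this work] -/
theorem v15Terms_equivariant : QuadEquivariant v15Terms := by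
  intro n τ x
  obtain ⟨a, b, c, y⟩ := x
  rfl
/-- `v12Terms` commutes with vertex relabellings. [this work] -/
theorem v12Terms_equivariant : QuadEquivariant v12Terms := by
  intro n τ x
  obtain ⟨a, b, c, y⟩ := x
  rfl

/-- `K₄` check for `V13` (base `2^23`). [this work] -/
theorem checkV13_4 : checkC 4 23 (v13Terms 4 (quad₀ 4 le_rfl)) = true := by native_decide
/-- `K₅` check for `V13` (base `2^35`). [this work] -/
theorem checkV13_5 : checkC 5 35 (v13Terms 5 (quad₀ 5 (by norm_num))) = true := by native_decide
/-- `K₄` check for `V15` (base `2^23`). [this work] -/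
theorem checkV15_4 : checkC 4 23 (v15Terms 4 (quad₀ 4 le_rfl)) = true := by native_decide
/-- `K₅` check for `V15` (base `2^35`). [this work] -/
theorem checkV15_5 : checkC 5 35 (v15Terms 5 (quad₀ 5 (by norm_num))) = true := by native_decide
/-- `K₄` check for `V12` (base `2^23`). [this work] -/
theorem checkV12_4 : checkC 4 23 (v12Terms 4 (quad₀ 4 le_rfl)) = true := by native_decide
/-- `K₅` check for `V12` (base `2^35`). [this work] -/
theorem checkV12_5 : checkC 5 35 (v12Terms 5 (quad₀ 5 (by norm_num))) = true := by native_decide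

/-- **`V13` (term form) on every weighted graph with at most five vertices.** [this work] -/
theorem v13_cval_le_five : ∀ n ≤ 5, ∀ (w : Sym2 (Fin n) → unitInterval) (a b c y : Fin n),
    a ≠ b → a ≠ c → a ≠ y → b ≠ c → b ≠ y → c ≠ y → 0 ≤ cval w (v13Terms n (a, b, c, y)) :=
  quad_cval_le_five v13Terms_equivariant checkV13_4 checkV13_5

/-- **`V15` (term form) on every weighted graph with at most five vertices.** [this work] -/
theorem v15_cval_le_five : ∀ n ≤ 5, ∀ (w : Sym2 (Fin n) → unitInterval) (a b c y : Fin n),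
    a ≠ b → a ≠ c → a ≠ y → b ≠ c → b ≠ y → c ≠ y → 0 ≤ cval w (v15Terms n (a, b, c, y)) :=
  quad_cval_le_five v15Terms_equivariant checkV15_4 checkV15_5

/-- **`V12` (term form) on every weighted graph with at most five vertices.** [this work] -/
theorem v12_cval_le_five : ∀ n ≤ 5, ∀ (w : Sym2 (Fin n) → unitInterval) (a b c y : Fin n),
    a ≠ b → a ≠ c → a ≠ y → b ≠ c → b ≠ y → c ≠ y → 0 ≤ cval w (v12Terms n (a, b, c, y)) :=
  quad_cval_le_five v12Terms_equivariant checkV12_4 checkV12_5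

/-! ## The two new cells as intersections of connection events -/

section cells
variable (a b c y : Fin n)

/-- Cell `aby|c` in `openConn` notation. [this work] -/
theorem connEvent_pKc : connEvent (pKc a b c y) =
    openConn a b ∩ (openConn a c)ᶜ ∩ openConn a y ∩ (openConn b c)ᶜ ∩ openConn b y ∩ (openConn c y)ᶜ := by
  ext ω
  simp only [connEvent, pKc, Set.mem_setOf_eq, Set.mem_inter_iff, Set.mem_compl_iff, Bool.and_eq_true, Bool.not_eq_true',
    decide_eq_true_eq, decide_eq_false_iff_not]
/-- Cell `abc|y` in `openConn` notation. [this work] -/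
theorem connEvent_pKy : connEvent (pKy a b c y) =
    openConn a b ∩ openConn a c ∩ (openConn a y)ᶜ ∩ openConn b c ∩ (openConn b y)ᶜ ∩ (openConn c y)ᶜ := by
  ext ω
  simp only [connEvent, pKy, Set.mem_setOf_eq, Set.mem_inter_iff, Set.mem_compl_iff, Bool.and_eq_true, Bool.not_eq_true',
    decide_eq_true_eq, decide_eq_false_iff_not]

end cells

/-- **`V12` on every weighted graph with at most five vertices**, in `openConn` notation: for `n ≤ 5`, every `w` and all pairwise distinct `a b c y`,
`P(ab|c|y)·P(a|b|cy) ≤ P(ab|cy)·[P(∅)+P(ab|c|y)+P(a|b|cy)] + P(∅)·[P(a|bcy)+P(acy|b)+P(aby|c)+P(abc|y)]`. [this work] -/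
theorem v12_le_five (hn : n ≤ 5) (w : Sym2 (Fin n) → unitInterval) (a b c y : Fin n) (hab : a ≠ b) (hac : a ≠ c) (hay : a ≠ y)
    (hbc : b ≠ c) (hby : b ≠ y) (hcy : c ≠ y) :
    (prodBernoulli w).real (connEvent (pSab a b c y)) * (prodBernoulli w).real (connEvent (pScy a b c y)) ≤
      (prodBernoulli w).real (connEvent (pP11 a b c y)) *
          ((prodBernoulli w).real (connEvent (pBot a b c y)) + (prodBernoulli w).real (connEvent (pSab a b c y)) +
            (prodBernoulli w).real (connEvent (pScy a b c y))) +
        (prodBernoulli w).real (connEvent (pBot a b c y)) *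
          ((prodBernoulli w).real (connEvent (pKa a b c y)) + (prodBernoulli w).real (connEvent (pKb a b c y)) +
            (prodBernoulli w).real (connEvent (pKc a b c y)) + (prodBernoulli w).real (connEvent (pKy a b c y))) := by
  have h := v12_cval_le_five n hn w a b c y hab hac hay hbc hby hcy
  unfold v12Terms cval at h
  simp only [List.map_cons, List.map_nil, List.sum_cons, List.sum_nil, pr_pTrue] at h
  unfold pr at h
  push_cast at h
  linarith

end Summit.CriticalPhenomena.PercolationContinuityZ3.Theorems.TwoLinkDeficit
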